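import Literature.Analysis.FluidPDE.ClassicalSolutionGalilean
import HarnessLib

/-!
# Extended Galilean covariance with a frame path smooth only near the time set

Analysis/FluidPDE support file (all results proved), companion of `ClassicalSolutionGalilean`.
There, `IsClassicalNSSolutionOn.galileanBoost` changes a classical Navier–Stokes solution on a
time set `S` to the accelerated frame `y = x − ξ(t)` for a frame path `ξ` that is smooth on ALL of
`ℝ`. For solutions living on `[0, T)` one wants frame paths that are smooth on a neighbourhood of
`[0, T)` only and may blow up at `T` (e.g. `ξ(t) = g(t) e` with `g(t) = ½ c t²/(T − t)`, the
accelerated frames of Jormakka, EJDE 2010/93, Thm. 2.3, whose speed `ξ′` is unbounded as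
`t → T⁻`): this file proves the same covariance statement under the weaker hypothesis
`ContDiffOn ℝ ∞ ξ U` for an OPEN set `U ⊇ S` (`IsClassicalNSSolutionOn.galileanBoostOn`), and its
`[0, T)` form with `U = (−∞, T)` (`IsClassicalNSSolutionOn.galileanBoostOn_Ico`). The algebra is
that of the tree's `galileanBoost` verbatim (the frame acceleration `ξ″` is balanced by the
uniform pressure gradient `∇⟪ξ″, y⟫`); only the smoothness bookkeeping is localised
(`contDiffOn_infty_iff_deriv_of_isOpen`; the plumbing lemmas are private).

Source of the symmetry: Majda–Bertozzi, *Vorticity and Incompressible Flow*, §1.2 (Galilean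
invariance) [MajdaBertozzi2002]; the accelerated-frame form with an arbitrary smooth frame
velocity `v(t)` on the life span of the solution is Tao, Anal. PDE 6 (2013), §3, eq. (galilean)
("valid for any smooth function `v`") [Tao2013Localisation].
-/

noncomputable section

open Set Function InnerProductSpace
open scoped Laplacian ContDiff RealInnerProductSpace Topology

namespace Literature.Analysis.FluidPDE

/-! ### Smoothness bookkeeping for paths smooth on an open set -/

section Path

variable {F : Type*} [NormedAddCommGroup F] [NormedSpace ℝ F]

/-- On an open set, the derivative of a `C^∞` path is `C^∞`
(Mathlib `contDiffOn_infty_iff_deriv_of_isOpen`). [folklore] -/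
private theorem contDiffOn_deriv_of_isOpen {U : Set ℝ} (hU : IsOpen U) {ξ : ℝ → F}
    (hξ : ContDiffOn ℝ ∞ ξ U) : ContDiffOn ℝ ∞ (deriv ξ) U :=
  ((contDiffOn_infty_iff_deriv_of_isOpen hU).1 hξ).2

/-- On an open set, a `C^∞` path has a derivative at every point. [folklore] -/
private theorem hasDerivAt_of_contDiffOn {U : Set ℝ} (hU : IsOpen U) {ξ : ℝ → F}
    (hξ : ContDiffOn ℝ ∞ ξ U) {t : ℝ} (ht : t ∈ U) : HasDerivAt ξ (deriv ξ t) t :=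
  ((hξ.differentiableOn (by simp) t ht).differentiableAt (hU.mem_nhds ht)).hasDerivAt

end Path

/-! ### Jointly smooth fields along paths smooth near the time set -/

section Curve

variable {X : Type*} [NormedAddCommGroup X] [NormedSpace ℝ X]
variable {F : Type*} [NormedAddCommGroup F] [NormedSpace ℝ F]

/-- Joint smoothness on `S × X` is preserved by a time-dependent translation of space along a path
that is smooth on a set `U ⊇ S`: `(t, y) ↦ w(t, y + ξ(t))`. [folklore] -/
private theorem IsSmoothSpaceTimeOn.comp_add_curveOn {S U : Set ℝ} {w : ℝ → X → F}
    (h : IsSmoothSpaceTimeOn S w) {ξ : ℝ → X} (hξ : ContDiffOn ℝ ∞ ξ U) (hSU : S ⊆ U) :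
    IsSmoothSpaceTimeOn S (fun t y => w t (y + ξ t)) := by
  have hξ' : ContDiffOn ℝ ∞ (fun z : ℝ × X => ξ z.1) (S ×ˢ (univ : Set X)) :=
    hξ.comp contDiffOn_fst fun z hz => hSU hz.1
  have hΨ : ContDiffOn ℝ ∞ (fun z : ℝ × X => ((z.1, z.2 + ξ z.1) : ℝ × X)) (S ×ˢ (univ : Set X)) :=
    contDiffOn_fst.prodMk (contDiffOn_snd.add hξ')
  have hmaps : MapsTo (fun z : ℝ × X => ((z.1, z.2 + ξ z.1) : ℝ × X)) (S ×ˢ (univ : Set X))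
      (S ×ˢ univ) := fun z hz => mk_mem_prod hz.1 (mem_univ _)
  have := h.comp hΨ hmaps
  refine this.congr fun z _ => ?_
  obtain ⟨t, y⟩ := z
  rfl

/-- Joint smoothness on `S × X` is preserved by subtracting a function of time smooth on `U ⊇ S`.
[folklore] -/
private theorem IsSmoothSpaceTimeOn.sub_timeOn {S U : Set ℝ} {w : ℝ → X → F}
    (h : IsSmoothSpaceTimeOn S w) {a : ℝ → F} (ha : ContDiffOn ℝ ∞ a U) (hSU : S ⊆ U) :
    IsSmoothSpaceTimeOn S (fun t y => w t y - a t) := by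
  have ha' : ContDiffOn ℝ ∞ (fun z : ℝ × X => a z.1) (S ×ˢ (univ : Set X)) :=
    ha.comp contDiffOn_fst fun z hz => hSU hz.1
  have := ContDiffOn.sub h ha'
  refine this.congr fun z _ => ?_
  obtain ⟨t, y⟩ := z
  rfl

/-- A function of `(t, y)` that is smooth on `U × X` is jointly smooth on `S × X` for `S ⊆ U`.
[folklore] -/
private theorem isSmoothSpaceTimeOn_of_contDiffOn {S U : Set ℝ} {w : ℝ → X → F}
    (h : ContDiffOn ℝ ∞ (uncurry w) (U ×ˢ univ)) (hSU : S ⊆ U) : IsSmoothSpaceTimeOn S w :=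
  h.mono (prod_mono hSU Subset.rfl)

end Curve

/-! ### Extended Galilean covariance, frame path smooth on an open neighbourhood of `S` -/

section Classical

variable {E : Type*} [NormedAddCommGroup E] [InnerProductSpace ℝ E] [FiniteDimensional ℝ E]
variable {S U : Set ℝ} {ν : ℝ} {f u : ℝ → E → E} {p : ℝ → E → ℝ}

omit [FiniteDimensional ℝ E] in
/-- **One-sided time derivative in the moving frame**, frame path smooth on an open `U ⊇ S`: for
`u` jointly smooth on `S × E`, `t ∈ S` of unique differentiability and `y ∈ E`,
`∂ₜ[u(·, · + ξ) − ξ'](t, y) = ∂ₜu(t, y + ξ t) + Du(t, y + ξ t)[ξ'(t)] − ξ''(t)` — the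
material-derivative computation behind "one can carefully check that this symmetry indeed maps …
smooth solutions to smooth solutions". [cite: Tao2013Localisation, §3 eq. (galilean)] -/
theorem timeDerivWithin_galileanBoostOn {u : ℝ → E → E} (hu : IsSmoothSpaceTimeOn S u)
    (hU : IsOpen U) (hSU : S ⊆ U) {ξ : ℝ → E} (hξ : ContDiffOn ℝ ∞ ξ U) {t : ℝ} (ht : t ∈ S)
    (hS : UniqueDiffWithinAt ℝ S t) (y : E) :
    timeDerivWithin S (fun s z => u s (z + ξ s) - deriv ξ s) t y =
      timeDerivWithin S u t (y + ξ t) + fderiv ℝ (u t) (y + ξ t) (deriv ξ t) -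
        deriv (deriv ξ) t := by
  have hξ' : ContDiffOn ℝ ∞ (deriv ξ) U := contDiffOn_deriv_of_isOpen hU hξ
  have hγ : HasDerivWithinAt (fun s => y + ξ s) (deriv ξ t) S t :=
    ((hasDerivAt_of_contDiffOn hU hξ (hSU ht)).const_add y).hasDerivWithinAt
  have h1 := hu.hasDerivWithinAt_comp_curve ht hS hγ
  have h2 : HasDerivWithinAt (fun s => deriv ξ s) (deriv (deriv ξ) t) S t :=
    (hasDerivAt_of_contDiffOn hU hξ' (hSU ht)).hasDerivWithinAt
  rw [timeDerivWithin_apply]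
  exact (h1.sub h2).derivWithin hS

/-- **Extended Galilean covariance, frame path smooth near the time set.** Let `(u, p)` be a
classical Navier–Stokes solution with viscosity `ν` and force `f` on a time set `S` of unique
differentiability, `U ⊇ S` open, and `ξ : ℝ → E` (frame path), `g : ℝ → ℝ` (pressure gauge)
smooth on `U`. Then `v(t, y) = u(t, y + ξ t) − ξ'(t)`, `q(t, y) = p(t, y + ξ t) + ⟪ξ''(t), y⟫ − g(t)`
is a classical solution on `S` with the same viscosity and force `f(t, y + ξ t)`. Same computation
as the tree's `IsClassicalNSSolutionOn.galileanBoost` (which is the case `U = ℝ`): the frame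
acceleration is balanced by the uniform pressure gradient `∇⟪ξ'', y⟫ = ξ''`. Majda–Bertozzi §1.2
(inertial frames); Tao 2013 §3 eq. (galilean) "valid for any smooth function `v`" on the life
span of the solution. [cite: Tao2013Localisation, §3 eq. (galilean)] -/
theorem IsClassicalNSSolutionOn.galileanBoostOn (h : IsClassicalNSSolutionOn S ν f u p)
    (hS : UniqueDiffOn ℝ S) (hU : IsOpen U) (hSU : S ⊆ U) {ξ : ℝ → E}
    (hξ : ContDiffOn ℝ ∞ ξ U) {g : ℝ → ℝ} (hg : ContDiffOn ℝ ∞ g U) :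
    IsClassicalNSSolutionOn S ν (fun t y => f t (y + ξ t)) (fun t y => u t (y + ξ t) - deriv ξ t)
      (fun t y => p t (y + ξ t) + ⟪deriv (deriv ξ) t, y⟫ - g t) where
  smooth_velocity :=
    (h.smooth_velocity.comp_add_curveOn hξ hSU).sub_timeOn (contDiffOn_deriv_of_isOpen hU hξ) hSU
  smooth_pressure := by
    have hξ'' : ContDiffOn ℝ ∞ (deriv (deriv ξ)) U :=
      contDiffOn_deriv_of_isOpen hU (contDiffOn_deriv_of_isOpen hU hξ)
    have hlin : IsSmoothSpaceTimeOn S (fun t (y : E) => ⟪deriv (deriv ξ) t, y⟫) := by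
      refine isSmoothSpaceTimeOn_of_contDiffOn (U := U) ?_ hSU
      exact (hξ''.comp contDiffOn_fst fun z hz => hz.1).inner ℝ contDiffOn_snd
    exact ((h.smooth_pressure.comp_add_curveOn hξ hSU).add hlin).sub_timeOn hg hSU
  momentum t ht y := by
    set x : E := y + ξ t with hx
    have hmom := h.momentum t ht x
    have hu2 : ContDiff ℝ 2 (u t) := (h.contDiff_velocity ht).of_le (by norm_cast)
    have hp1 : Differentiable ℝ (p t) := (h.contDiff_pressure ht).differentiable (by simp)
    -- time derivative in the moving frame
    have hT := timeDerivWithin_galileanBoostOn h.smooth_velocity hU hSU hξ ht (hS t ht) y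
    -- convective term
    have hC : convect ((fun s z => u s (z + ξ s) - deriv ξ s) t)
        ((fun s z => u s (z + ξ s) - deriv ξ s) t) y =
        fderiv ℝ (u t) x (u t x) - fderiv ℝ (u t) x (deriv ξ t) := by
      simp only [convect_apply]
      rw [fderiv_comp_add_right_sub_const, map_sub]
    -- Laplacian
    have hL : (Δ ((fun s z => u s (z + ξ s) - deriv ξ s) t)) y = (Δ (u t)) x :=
      laplacian_comp_add_right_sub_const hu2 (ξ t) (deriv ξ t) y
    -- pressure gradient
    have hG : gradient ((fun s z => p s (z + ξ s) + ⟪deriv (deriv ξ) s, z⟫ - g s) t) y =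
        gradient (p t) x + deriv (deriv ξ) t :=
      gradient_comp_add_right_add_inner_sub_const hp1 (ξ t) (deriv (deriv ξ) t) (g t) y
    rw [hT, hC, hL, hG]
    rw [convect_apply] at hmom
    have hA : timeDerivWithin S u t x =
        ν • (Δ (u t)) x - gradient (p t) x + f t x - fderiv ℝ (u t) x (u t x) :=
      eq_sub_of_add_eq hmom
    rw [hA]
    abel
  divFree t ht y := by
    change VectorCalculus.divergence (fun z => u t (z + ξ t) - deriv ξ t) y = 0
    rw [divergence_comp_add_right_sub_const]
    exact h.divFree t ht (y + ξ t)

/-- **Extended Galilean covariance on `[0, T)` with a frame path smooth on `(−∞, T)`** (it may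
blow up at `T`): for `ξ`, `g` smooth on `Iio T`,
`(u(t, y + ξ t) − ξ'(t), p(t, y + ξ t) + ⟪ξ''(t), y⟫ − g t)` is an unforced classical solution on
`[0, T)` whenever `(u, p)` is. This is the form producing solutions on `[0, T)` that become
unbounded as `t → T⁻` from global ones (Jormakka, EJDE 2010/93, Thm. 2.3: `g(t) = ½ct²/(T−t)`).
[cite: Tao2013Localisation, §3 eq. (galilean)] -/
theorem IsClassicalNSSolutionOn.galileanBoostOn_Ico {T : ℝ} {u : ℝ → E → E} {p : ℝ → E → ℝ}
    (h : IsClassicalNSSolutionOn (Ico 0 T) ν 0 u p) {ξ : ℝ → E} (hξ : ContDiffOn ℝ ∞ ξ (Iio T))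
    {g : ℝ → ℝ} (hg : ContDiffOn ℝ ∞ g (Iio T)) :
    IsClassicalNSSolutionOn (Ico 0 T) ν 0 (fun t y => u t (y + ξ t) - deriv ξ t)
      (fun t y => p t (y + ξ t) + ⟪deriv (deriv ξ) t, y⟫ - g t) :=
  h.galileanBoostOn (uniqueDiffOn_Ico 0 T) isOpen_Iio (fun _ ht => ht.2) hξ hg

end Classical

end Literature.Analysis.FluidPDE

end
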